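import Literature.MathematicalPhysics.QuantumLattice.GibbsEnergyEntropyBalanceMatrixCuts
import Literature.Analysis.Quadrature.LogLeftRadauBound
import HarnessLib

/-!
# Structural certificate for MATRIX energy–entropy-balance cuts: tangent rows of the composite
# left-Radau perspective model satisfy the one-parameter semidefinite condition

Topic `Literature/MathematicalPhysics/QuantumLattice`; reader-side complement of
`GibbsEnergyEntropyBalanceMatrixCuts.lean` (a matrix cut `(Λ_A, Λ_B, Λ_C)` is valid for every Gibbs
eigen-mixture and every thermal torus limit as soon as `Λ_A + e^{−x}Λ_B + xΛ_C ⪰ 0` for every real `x`) and of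
`MatrixCutGridCertificate.lean` (that ONE-PARAMETER CONDITION from finitely many strict semidefinite tests).
The PRODUCTION rows of the certified thermal relaxations — Fawzi–Fawzi–Scalet's matrix energy–entropy balance
`D_op(A‖B) ⪯ βC` (Thm. 3.4) linearised through the rational upper model of the logarithm of
Fawzi–Saunderson–Parrilo / Cho–Gabai–Sandor–Yin — are TIGHT: their one-parameter family is singular and
touches zero at `x = 0`, so no strict numerical grid test can certify them. This file certifies them
STRUCTURALLY, by an exact algebraic identity.

## The construction being certified (producer side, for orientation only)

With `f_t(y) = (y − 1)/(1 + t(y − 1))` one has `log y = ∫₀¹ f_t(y) dt`, and a rule `r = Σ_j w_j f_{t_j}`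
(nodes `t_j ∈ [0,1]`, weights `w_j ≥ 0`) bounding `log` FROM ABOVE on `(0, ∞)` (left-Radau rules,
`Literature/Analysis/Quadrature/LogLeftRadauBound.lean`). The operator perspective
`P_t(A,B) = A^{1/2} f_t(A^{-1/2} B A^{-1/2}) A^{1/2} = (1/t)(A − A((1−t)A + tB)⁻¹A)` is jointly concave, so for
`W ⪰ 0` the functional `Ψ(A,B) = tr(W Σ_j w_j P_{t_j}(A,B))` is concave and positively homogeneous; its
tangent at `(A₀, B₀) ≻ 0` is the linear form `tr(G_A A) + tr(G_B B)` with, per node,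
`G_B = K W Kᴴ`, `G_A = (1/t)(1 − K) W (1 − K)ᴴ − K W Kᴴ`, `K = ((1−t)A₀ + tB₀)⁻¹ A₀`, and the certified row is
`tr(G_A A) + tr(G_B B) + β tr(W C) ≥ 0`, i.e. the matrix cut `(Λ_A, Λ_B, Λ_C) = (G_A, G_B, W)`.

## What is proved (no operator convexity, no functional calculus)

* §1 `radauNode_pencil_eq_smul`, `posSemidef_radauNode_pencil` — PER NODE, for an ARBITRARY square
  matrix `K` (the tangent point only parametrises `K`): with `d = 1 + t(y − 1)`,
  `(1/t)(1−K)W(1−K)ᴴ − KWKᴴ + y·KWKᴴ − f_t(y)·W = (1/(t d))·(dK − 1)W(dK − 1)ᴴ ⪰ 0` (`t ∈ (0,1]`, `y > 0`);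
  the node `t = 0` (`K = 1`) contributes `0`.
* §2 `posSemidef_oneParam_of_perspectiveTangent` — for any finite rule with `log ≤ Σ_j w_j f_{t_j}` on
  `(0,∞)` and any `K_j` (`K_j = 1` where `t_j = 0`, unless `w_j = 0`), the triple
  `(Σ_j w_j G_A^{(j)}, Σ_j w_j G_B^{(j)}, W)` satisfies `Λ_A + e^{−x}Λ_B + xΛ_C ⪰ 0` for EVERY real `x`
  (put `y = e^{−x}`: the family is `Σ_j w_j·(node pencil at y) + (r(y) − log y)·W`).
* §3 `posSemidef_oneParam_mono` (weakening `Λ_A' ⪰ Λ_A`, `Λ_B' ⪰ Λ_B`, same `Λ_C`: how an outward-rounded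
  production row is accepted against the exactly rebuilt triple), `posSemidef_oneParam_add_smul`,
  `posSemidef_oneParam_conj` (congruence `Λ ↦ SᴴΛS`: a change of generators, e.g. «diag-frame» rows).
* §4 `posSemidef_oneParam_of_radauTwoTangent` — the packaged statement for the producers' COMPOSITE
  two-point left-Radau rule (`radau2_mesh`: panels of a mesh `0 = a₀ < … < a_N = 1`, nodes `a_k`,
  `a_k + ⅔h_k`, weights `h_k/4`, `3h_k/4`), via `log_le_radauTwo_composite`.

The conclusion is literally the hypothesis `hΛ` of `sum_exp_mul_re_expect_matrixCut_nonneg`,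
`sum_canonicalWeight_mul_re_expect_matrixCut_nonneg` (this directory) and of the torus-limit row theorem
`IsTorusLimitOfMixture.re_expect_matrixCut_nonneg_of_sectorGibbs_of_thicken_subset`. Everything is PROVED;
no definition, no named fact.

## Mathlib / tree search

REUSED: Mathlib `Matrix.PosSemidef.mul_mul_conjTranspose_same`, `.conjTranspose_mul_mul_same`, `.smul`,
`.add`, `Matrix.posSemidef_sum`, `Finset.sum_disjSum`; tree `log_le_radauTwo_composite`
(`Literature/Analysis/Quadrature/LogLeftRadauBound.lean`), the statement shape of the one-parameter
condition of `GibbsEnergyEntropyBalanceMatrixCuts.lean` (copied verbatim).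
`lean search 'perspective|radauNode_pencil|oneParam_of'`: no prior structural certificate (2026-08-26).

## References

* H. Fawzi, O. Fawzi, S. O. Scalet, Nat. Commun. 15 (2024) 7394 = arXiv:2311.18706, §3.2 Thm. 3.4,
  Prop. 3.5. [cite: FawziFawziScalet2024, Thm. 3.4]
* H. Fawzi, J. Saunderson, P. A. Parrilo, Found. Comput. Math. 19 (2019) 259, §2 eqs. (4)–(6), Thm. 3
  (operator concavity of the rational model). [cite: FawziSaundersonParrilo2019, §2]
* M. Cho, B. Gabai, J. Sandor, X. Yin, JHEP 04 (2025) 186 = arXiv:2410.04262, §2.1. [cite: ChoEtAl2025, §2.1]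
-/

noncomputable section

namespace Literature.MathematicalPhysics.QuantumLattice

open Matrix Finset Literature.Analysis.Quadrature
open scoped ComplexOrder BigOperators

/-! ### §1 The per-node identity -/

section Node

variable {m : Type*} [Fintype m] [DecidableEq m]

/-- Expansion `(1 − K) W (1 − K)ᴴ = W − KW − WKᴴ + KWKᴴ`. [folklore] -/
private theorem one_sub_mul_mul_conjTranspose_one_sub (W K : Matrix m m ℂ) :
    (1 - K) * W * (1 - K)ᴴ = W - K * W - W * Kᴴ + K * W * Kᴴ := by
  rw [Matrix.conjTranspose_sub, Matrix.conjTranspose_one]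
  simp only [sub_mul, mul_sub, one_mul, mul_one]
  abel

/-- Expansion `(d•K − 1) W (d•K − 1)ᴴ = d²·KWKᴴ − d·KW − d·WKᴴ + W` for real `d`. [folklore] -/
private theorem smul_sub_one_mul_mul_conjTranspose (W K : Matrix m m ℂ) (d : ℝ) :
    (((d : ℝ) : ℂ) • K - 1) * W * (((d : ℝ) : ℂ) • K - 1)ᴴ =
      ((d * d : ℝ) : ℂ) • (K * W * Kᴴ) - ((d : ℝ) : ℂ) • (K * W) - ((d : ℝ) : ℂ) • (W * Kᴴ) + W := by
  have hstar : star ((d : ℝ) : ℂ) = ((d : ℝ) : ℂ) := by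
    rw [Complex.star_def, Complex.conj_ofReal]
  rw [Matrix.conjTranspose_sub, Matrix.conjTranspose_one, Matrix.conjTranspose_smul, hstar]
  simp only [sub_mul, mul_sub, one_mul, mul_one, Matrix.smul_mul, Matrix.mul_smul, smul_smul]
  push_cast
  module

/-- **Per-node identity (solved form).** For every square matrix `K`, every `W`, and reals `t ≠ 0`, `y`
with `d := 1 + t(y − 1) ≠ 0`:
`(1/t)(1−K)W(1−K)ᴴ − KWKᴴ + y·KWKᴴ − ((y−1)/d)·W = (1/(t d)) · (dK − 1) W (dK − 1)ᴴ`
(scalar case `m = 1`, `W = 1`, `K = k`: `t d · (…) = (dk − 1)²`). This is the algebra behind the validity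
of the tangent rows of the perspective model `P_t(A,B) = (1/t)(A − A((1−t)A+tB)⁻¹A)` of
Fawzi–Saunderson–Parrilo, for which `K = ((1−t)A₀ + tB₀)⁻¹A₀`. [cite: FawziSaundersonParrilo2019, §2] -/
theorem radauNode_pencil_eq_smul (W K : Matrix m m ℂ) {t y : ℝ} (ht : t ≠ 0)
    (hd : 1 + t * (y - 1) ≠ 0) :
    (((1 / t : ℝ) : ℂ) • ((1 - K) * W * (1 - K)ᴴ) - K * W * Kᴴ) + ((y : ℝ) : ℂ) • (K * W * Kᴴ) -
        (((y - 1) / (1 + t * (y - 1)) : ℝ) : ℂ) • W =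
      ((1 / (t * (1 + t * (y - 1))) : ℝ) : ℂ) •
        ((((1 + t * (y - 1) : ℝ) : ℂ) • K - 1) * W * (((1 + t * (y - 1) : ℝ) : ℂ) • K - 1)ᴴ) := by
  -- make `d := 1 + t (y - 1)` atomic
  set d : ℝ := 1 + t * (y - 1) with hd_def
  -- scalar identities
  have c1 : 1 / t - 1 + y = 1 / (t * d) * (d * d) := by
    rw [hd_def]
    field_simp
    ring
  have c3 : 1 / t - (y - 1) / d = 1 / (t * d) := by
    field_simp
    rw [hd_def]
    ring
  have c2 : 1 / t = 1 / (t * d) * d := by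
    field_simp
  rw [smul_sub_one_mul_mul_conjTranspose, one_sub_mul_mul_conjTranspose_one_sub]
  calc (((1 / t : ℝ) : ℂ) • (W - K * W - W * Kᴴ + K * W * Kᴴ) - K * W * Kᴴ) +
          ((y : ℝ) : ℂ) • (K * W * Kᴴ) - (((y - 1) / d : ℝ) : ℂ) • W
        = ((1 / t - 1 + y : ℝ) : ℂ) • (K * W * Kᴴ) - ((1 / t : ℝ) : ℂ) • (K * W) -
            ((1 / t : ℝ) : ℂ) • (W * Kᴴ) + ((1 / t - (y - 1) / d : ℝ) : ℂ) • W := by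
          push_cast
          module
    _ = ((1 / (t * d) * (d * d) : ℝ) : ℂ) • (K * W * Kᴴ) - ((1 / (t * d) * d : ℝ) : ℂ) • (K * W) -
          ((1 / (t * d) * d : ℝ) : ℂ) • (W * Kᴴ) + ((1 / (t * d) : ℝ) : ℂ) • W := by
          rw [c1, c3, c2]
    _ = ((1 / (t * d) : ℝ) : ℂ) •
          (((d * d : ℝ) : ℂ) • (K * W * Kᴴ) - ((d : ℝ) : ℂ) • (K * W) - ((d : ℝ) : ℂ) • (W * Kᴴ) + W) := by
          push_cast
          module

/-- **Per-node positivity.** Let `W ⪰ 0`, `K` any square matrix, `t ∈ [0,1]` with `K = 1` if `t = 0`,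
and `y > 0`. Then the value at `y` of the one-parameter family of the node-`t` tangent triple
`(G_A, G_B, W) = ((1/t)(1−K)W(1−K)ᴴ − KWKᴴ, KWKᴴ, W)` against the node function `f_t(y) = (y−1)/(1+t(y−1))`
is positive semidefinite: `G_A + y·G_B − f_t(y)·W = (1/(t d))(dK − 1)W(dK − 1)ᴴ ⪰ 0` (`d = 1 + t(y−1) > 0`),
resp. `= 0` for `t = 0`. [cite: FawziSaundersonParrilo2019, §2] -/
theorem posSemidef_radauNode_pencil {W : Matrix m m ℂ} (hW : W.PosSemidef) (K : Matrix m m ℂ)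
    {t y : ℝ} (ht0 : 0 ≤ t) (ht1 : t ≤ 1) (hK : t = 0 → K = 1) (hy : 0 < y) :
    ((((1 / t : ℝ) : ℂ) • ((1 - K) * W * (1 - K)ᴴ) - K * W * Kᴴ) + ((y : ℝ) : ℂ) • (K * W * Kᴴ) -
        (((y - 1) / (1 + t * (y - 1)) : ℝ) : ℂ) • W).PosSemidef := by
  rcases ht0.eq_or_lt with h0 | hpos
  · -- the affine node `t = 0`: `K = 1`, the family is identically `0`
    have hK1 : K = 1 := hK h0.symm
    subst hK1
    have hzero : ((((1 / t : ℝ) : ℂ) • ((1 - (1 : Matrix m m ℂ)) * W * (1 - (1 : Matrix m m ℂ))ᴴ) -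
          1 * W * (1 : Matrix m m ℂ)ᴴ) + ((y : ℝ) : ℂ) • (1 * W * (1 : Matrix m m ℂ)ᴴ) -
        (((y - 1) / (1 + t * (y - 1)) : ℝ) : ℂ) • W) = 0 := by
      rw [← h0]
      simp only [sub_self, zero_mul, smul_zero, zero_sub, Matrix.conjTranspose_one, mul_one, one_mul,
        add_zero, div_one]
      push_cast
      module
    rw [hzero]
    exact Matrix.PosSemidef.zero
  · have hd : 0 < 1 + t * (y - 1) := by
      have h := mul_pos hpos hy
      nlinarith
    rw [radauNode_pencil_eq_smul W K hpos.ne' hd.ne']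
    refine (hW.mul_mul_conjTranspose_same _).smul (Complex.zero_le_real.2 ?_)
    positivity

end Node

/-! ### §2 Any rule dominating `log`: the tangent triple satisfies the one-parameter condition -/

section Rule

variable {m : Type*} [Fintype m] [DecidableEq m]

/-- **Structural certificate, abstract rule.** Let `W ⪰ 0`, and let `(t_j, w_j)_{j ∈ s}` be a finite rule
with nodes `t_j ∈ [0,1]`, weights `w_j ≥ 0`, such that `log y ≤ Σ_j w_j (y−1)/(1+t_j(y−1))` for every `y > 0`
(e.g. any left-Radau rule of `∫₀¹ f_t dt = log`). Let `K_j` be ARBITRARY square matrices with `K_j = 1`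
whenever `t_j = 0` and `w_j ≠ 0`. Then the tangent triple
`Λ_A = Σ_j w_j[(1/t_j)(1−K_j)W(1−K_j)ᴴ − K_jWK_jᴴ]`, `Λ_B = Σ_j w_j K_jWK_jᴴ`, `Λ_C = W`
satisfies the ONE-PARAMETER SEMIDEFINITE CONDITION `Λ_A + e^{−x}Λ_B + xΛ_C ⪰ 0` for every real `x` — the
hypothesis of `sum_exp_mul_re_expect_matrixCut_nonneg` (validity of the matrix cut for Gibbs states). With
`K_j = ((1−t_j)A₀ + t_jB₀)⁻¹A₀` this is the tangent row at `(A₀,B₀)` of the concave functional `tr(W P_r(A,B))`,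
`P_r = Σ_j w_j P_{t_j}`, used to linearise the matrix energy–entropy balance `D_op(A‖B) ⪯ βC`. Proof: put
`y = e^{−x}`; the family equals `Σ_j w_j (G_A^{(j)} + yG_B^{(j)} − f_{t_j}(y)W) + (r(y) − log y)·W`, a sum
of PSD terms (§1). [cite: FawziFawziScalet2024, Thm. 3.4] -/
theorem posSemidef_oneParam_of_perspectiveTangent {ι : Type*} (s : Finset ι) {W : Matrix m m ℂ}
    (hW : W.PosSemidef) (t w : ι → ℝ) (K : ι → Matrix m m ℂ)
    (ht : ∀ j ∈ s, 0 ≤ t j ∧ t j ≤ 1) (hw : ∀ j ∈ s, 0 ≤ w j)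
    (hK : ∀ j ∈ s, t j = 0 → K j = 1 ∨ w j = 0)
    (hrule : ∀ y : ℝ, 0 < y → Real.log y ≤ ∑ j ∈ s, w j * ((y - 1) / (1 + t j * (y - 1))))
    (x : ℝ) :
    ((∑ j ∈ s, ((w j : ℝ) : ℂ) •
          ((((1 / t j : ℝ) : ℂ) • ((1 - K j) * W * (1 - K j)ᴴ) - K j * W * (K j)ᴴ))) +
        ((Real.exp (-x) : ℝ) : ℂ) • (∑ j ∈ s, ((w j : ℝ) : ℂ) • (K j * W * (K j)ᴴ)) +
        ((x : ℝ) : ℂ) • W).PosSemidef := by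
  have hy : 0 < Real.exp (-x) := Real.exp_pos _
  have hlog : Real.log (Real.exp (-x)) = -x := Real.log_exp _
  -- regroup: node pencils + (rule − log) · W
  have hterm : ∀ j, ((w j : ℝ) : ℂ) •
        (((((1 / t j : ℝ) : ℂ) • ((1 - K j) * W * (1 - K j)ᴴ) - K j * W * (K j)ᴴ)) +
            ((Real.exp (-x) : ℝ) : ℂ) • (K j * W * (K j)ᴴ) -
          ((((Real.exp (-x)) - 1) / (1 + t j * ((Real.exp (-x)) - 1)) : ℝ) : ℂ) • W) =
      ((w j : ℝ) : ℂ) • ((((1 / t j : ℝ) : ℂ) • ((1 - K j) * W * (1 - K j)ᴴ) - K j * W * (K j)ᴴ)) +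
        ((Real.exp (-x) : ℝ) : ℂ) • (((w j : ℝ) : ℂ) • (K j * W * (K j)ᴴ)) -
        ((w j * (((Real.exp (-x)) - 1) / (1 + t j * ((Real.exp (-x)) - 1))) : ℝ) : ℂ) • W := by
    intro j
    push_cast
    module
  have hsplit :
      (∑ j ∈ s, ((w j : ℝ) : ℂ) •
            ((((1 / t j : ℝ) : ℂ) • ((1 - K j) * W * (1 - K j)ᴴ) - K j * W * (K j)ᴴ))) +
          ((Real.exp (-x) : ℝ) : ℂ) • (∑ j ∈ s, ((w j : ℝ) : ℂ) • (K j * W * (K j)ᴴ)) +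
          ((x : ℝ) : ℂ) • W =
        (∑ j ∈ s, ((w j : ℝ) : ℂ) •
            (((((1 / t j : ℝ) : ℂ) • ((1 - K j) * W * (1 - K j)ᴴ) - K j * W * (K j)ᴴ)) +
                ((Real.exp (-x) : ℝ) : ℂ) • (K j * W * (K j)ᴴ) -
              ((((Real.exp (-x)) - 1) / (1 + t j * ((Real.exp (-x)) - 1)) : ℝ) : ℂ) • W)) +
          (((∑ j ∈ s, w j * (((Real.exp (-x)) - 1) / (1 + t j * ((Real.exp (-x)) - 1)))) + x : ℝ) :
              ℂ) • W := by
    simp_rw [hterm, Finset.sum_sub_distrib, Finset.sum_add_distrib, ← Finset.smul_sum,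
      ← Finset.sum_smul]
    push_cast
    module
  rw [hsplit]
  refine Matrix.PosSemidef.add (Matrix.posSemidef_sum s fun j hj => ?_) (hW.smul ?_)
  · rcases eq_or_ne (w j) 0 with hw0 | hw0
    · rw [hw0, Complex.ofReal_zero, zero_smul]
      exact Matrix.PosSemidef.zero
    · have hKj : t j = 0 → K j = 1 := fun h0 => (hK j hj h0).resolve_right hw0
      exact (posSemidef_radauNode_pencil hW (K j) (ht j hj).1 (ht j hj).2 hKj hy).smul
        (Complex.zero_le_real.2 (hw j hj))
  · refine Complex.zero_le_real.2 ?_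
    have h := hrule (Real.exp (-x)) hy
    rw [hlog] at h
    linarith

end Rule

/-! ### §3 Weakening, positive combinations and congruence of the one-parameter condition -/

section Mono

variable {m : Type*}

/-- **Weakening.** If `(Λ_A, Λ_B, Λ_C)` satisfies the one-parameter condition and `Λ_A' − Λ_A ⪰ 0`,
`Λ_B' − Λ_B ⪰ 0`, then so does `(Λ_A', Λ_B', Λ_C)` — how a reader accepts an OUTWARD-ROUNDED production row
against the exactly rebuilt tangent triple. [cite: FawziFawziScalet2024, Thm. 3.4] -/
theorem posSemidef_oneParam_mono {ΛA ΛA' ΛB ΛB' ΛC : Matrix m m ℂ}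
    (hΛ : ∀ x : ℝ, (ΛA + ((Real.exp (-x) : ℝ) : ℂ) • ΛB + ((x : ℝ) : ℂ) • ΛC).PosSemidef)
    (hA : (ΛA' - ΛA).PosSemidef) (hB : (ΛB' - ΛB).PosSemidef) (x : ℝ) :
    (ΛA' + ((Real.exp (-x) : ℝ) : ℂ) • ΛB' + ((x : ℝ) : ℂ) • ΛC).PosSemidef := by
  have key : ΛA' + ((Real.exp (-x) : ℝ) : ℂ) • ΛB' + ((x : ℝ) : ℂ) • ΛC =
      (ΛA + ((Real.exp (-x) : ℝ) : ℂ) • ΛB + ((x : ℝ) : ℂ) • ΛC) + (ΛA' - ΛA) +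
        ((Real.exp (-x) : ℝ) : ℂ) • (ΛB' - ΛB) := by
    module
  rw [key]
  exact ((hΛ x).add hA).add (hB.smul (Complex.zero_le_real.2 (Real.exp_pos _).le))

/-- **Positive combinations.** The one-parameter condition is preserved under `(Λ, Λ') ↦ Λ + κ Λ'`,
`κ ≥ 0` (aggregating certified rows). [cite: FawziFawziScalet2024, Thm. 3.4] -/
theorem posSemidef_oneParam_add_smul {ΛA ΛA' ΛB ΛB' ΛC ΛC' : Matrix m m ℂ}
    (hΛ : ∀ x : ℝ, (ΛA + ((Real.exp (-x) : ℝ) : ℂ) • ΛB + ((x : ℝ) : ℂ) • ΛC).PosSemidef)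
    (hΛ' : ∀ x : ℝ, (ΛA' + ((Real.exp (-x) : ℝ) : ℂ) • ΛB' + ((x : ℝ) : ℂ) • ΛC').PosSemidef)
    {κ : ℝ} (hκ : 0 ≤ κ) (x : ℝ) :
    ((ΛA + ((κ : ℝ) : ℂ) • ΛA') + ((Real.exp (-x) : ℝ) : ℂ) • (ΛB + ((κ : ℝ) : ℂ) • ΛB') +
      ((x : ℝ) : ℂ) • (ΛC + ((κ : ℝ) : ℂ) • ΛC')).PosSemidef := by
  have key : (ΛA + ((κ : ℝ) : ℂ) • ΛA') + ((Real.exp (-x) : ℝ) : ℂ) • (ΛB + ((κ : ℝ) : ℂ) • ΛB') +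
        ((x : ℝ) : ℂ) • (ΛC + ((κ : ℝ) : ℂ) • ΛC') =
      (ΛA + ((Real.exp (-x) : ℝ) : ℂ) • ΛB + ((x : ℝ) : ℂ) • ΛC) +
        ((κ : ℝ) : ℂ) • (ΛA' + ((Real.exp (-x) : ℝ) : ℂ) • ΛB' + ((x : ℝ) : ℂ) • ΛC') := by
    module
  rw [key]
  exact (hΛ x).add ((hΛ' x).smul (Complex.zero_le_real.2 hκ))

/-- **Congruence.** The one-parameter condition is preserved under `Λ ↦ Sᴴ Λ S` applied to all three
matrices (any rectangular `S`) — a change of generators `a'_i = Σ_k S_{ki} a_k` on the producer side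
(e.g. the «diag-frame» rows built in a transformed family and transformed back).
[cite: FawziFawziScalet2024, Thm. 3.4] -/
theorem posSemidef_oneParam_conj [Fintype m] {n : Type*} [Finite n] {ΛA ΛB ΛC : Matrix m m ℂ}
    (hΛ : ∀ x : ℝ, (ΛA + ((Real.exp (-x) : ℝ) : ℂ) • ΛB + ((x : ℝ) : ℂ) • ΛC).PosSemidef)
    (S : Matrix m n ℂ) (x : ℝ) :
    (Sᴴ * ΛA * S + ((Real.exp (-x) : ℝ) : ℂ) • (Sᴴ * ΛB * S) +
      ((x : ℝ) : ℂ) • (Sᴴ * ΛC * S)).PosSemidef := by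
  have key : Sᴴ * ΛA * S + ((Real.exp (-x) : ℝ) : ℂ) • (Sᴴ * ΛB * S) +
        ((x : ℝ) : ℂ) • (Sᴴ * ΛC * S) =
      Sᴴ * (ΛA + ((Real.exp (-x) : ℝ) : ℂ) • ΛB + ((x : ℝ) : ℂ) • ΛC) * S := by
    simp only [Matrix.mul_add, Matrix.add_mul, Matrix.mul_smul, Matrix.smul_mul]
  rw [key]
  exact (hΛ x).conjTranspose_mul_mul_same S

end Mono

/-! ### §4 The packaged statement for composite two-point left-Radau tangent rows -/

section Packaged

variable {m : Type*} [Fintype m] [DecidableEq m]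

/-- **Structural certificate for the production eeb-mat rows.** Data: a weight `W ⪰ 0`; a mesh
`0 = a₀ < a₁ < … < a_N = 1` (`radau2_mesh`); for every panel `k < N` (width `h_k = a_{k+1} − a_k`, nodes
`t = a_k` and `t = a_k + ⅔h_k`, weights `h_k/4`, `3h_k/4`) two ARBITRARY square matrices `K₁ k`, `K₂ k` with
`K₁ 0 = 1` (the node `t = 0`). In the producers' construction `K = ((1−t)A₀ + tB₀)⁻¹A₀` at the exact
rational tangent point `(A₀, B₀)` of the sidecar — validity does not depend on that. Then the triple
`Λ_A = Σ_k (h_k/4)[(1/a_k)(1−K₁)W(1−K₁)ᴴ − K₁WK₁ᴴ] + Σ_k (3h_k/4)[(1/t₂)(1−K₂)W(1−K₂)ᴴ − K₂WK₂ᴴ]`,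
`Λ_B = Σ_k (h_k/4) K₁WK₁ᴴ + Σ_k (3h_k/4) K₂WK₂ᴴ`, `Λ_C = W`
satisfies `Λ_A + e^{−x}Λ_B + xΛ_C ⪰ 0` for EVERY real `x`: the hypothesis `hΛ` of
`sum_exp_mul_re_expect_matrixCut_nonneg`, `sum_canonicalWeight_mul_re_expect_matrixCut_nonneg` and
`IsTorusLimitOfMixture.re_expect_matrixCut_nonneg_of_sectorGibbs_of_thicken_subset`. A shipped row
`(Λ_A', Λ_B', W)` with `Λ_A' − Λ_A ⪰ 0`, `Λ_B' − Λ_B ⪰ 0` is then valid by `posSemidef_oneParam_mono`. (Lean's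
`1/0 = 0` makes the `k = 0` first-node term `−K₁WK₁ᴴ = −W`, the affine node `f_0(y) = y − 1`.)
[cite: FawziFawziScalet2024, Thm. 3.4] -/
theorem posSemidef_oneParam_of_radauTwoTangent {W : Matrix m m ℂ} (hW : W.PosSemidef)
    (a : ℕ → ℝ) (N : ℕ) (hmono : StrictMono a) (h0 : a 0 = 0) (hN : a N = 1)
    (K₁ K₂ : ℕ → Matrix m m ℂ) (hK0 : K₁ 0 = 1) (x : ℝ) :
    (((∑ k ∈ Finset.range N, (((a (k + 1) - a k) / 4 : ℝ) : ℂ) •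
          (((1 / a k : ℝ) : ℂ) • ((1 - K₁ k) * W * (1 - K₁ k)ᴴ) - K₁ k * W * (K₁ k)ᴴ)) +
        (∑ k ∈ Finset.range N, ((3 * (a (k + 1) - a k) / 4 : ℝ) : ℂ) •
          (((1 / (a k + 2 / 3 * (a (k + 1) - a k)) : ℝ) : ℂ) • ((1 - K₂ k) * W * (1 - K₂ k)ᴴ) -
            K₂ k * W * (K₂ k)ᴴ))) +
      ((Real.exp (-x) : ℝ) : ℂ) •
        ((∑ k ∈ Finset.range N, (((a (k + 1) - a k) / 4 : ℝ) : ℂ) • (K₁ k * W * (K₁ k)ᴴ)) +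
          (∑ k ∈ Finset.range N, ((3 * (a (k + 1) - a k) / 4 : ℝ) : ℂ) • (K₂ k * W * (K₂ k)ᴴ))) +
      ((x : ℝ) : ℂ) • W).PosSemidef := by
  -- index the two nodes of each panel by `ℕ ⊕ ℕ`
  set t : ℕ ⊕ ℕ → ℝ := Sum.elim (fun k => a k) (fun k => a k + 2 / 3 * (a (k + 1) - a k)) with ht_def
  set w : ℕ ⊕ ℕ → ℝ := Sum.elim (fun k => (a (k + 1) - a k) / 4) (fun k => 3 * (a (k + 1) - a k) / 4)
    with hw_def
  set K : ℕ ⊕ ℕ → Matrix m m ℂ := Sum.elim K₁ K₂ with hK_def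
  have hak0 : ∀ k, 0 ≤ a k := fun k => h0 ▸ hmono.monotone (Nat.zero_le k)
  have hak1 : ∀ k, k ≤ N → a k ≤ 1 := fun k hk => hN ▸ hmono.monotone hk
  have hstep : ∀ k, a k < a (k + 1) := fun k => hmono (Nat.lt_succ_self k)
  have ht : ∀ j ∈ (Finset.range N).disjSum (Finset.range N), 0 ≤ t j ∧ t j ≤ 1 := by
    intro j hj
    rcases j with k | k
    · have hk : k < N := Finset.mem_range.1 (Finset.inl_mem_disjSum.1 hj)
      exact ⟨by simpa [ht_def] using hak0 k, by simpa [ht_def] using hak1 k hk.le⟩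
    · have hk : k < N := Finset.mem_range.1 (Finset.inr_mem_disjSum.1 hj)
      have h1 := hstep k
      have h2 := hak1 (k + 1) hk
      have h3 := hak0 k
      refine ⟨?_, ?_⟩
      · simp only [ht_def, Sum.elim_inr]
        nlinarith
      · simp only [ht_def, Sum.elim_inr]
        nlinarith
  have hw : ∀ j ∈ (Finset.range N).disjSum (Finset.range N), 0 ≤ w j := by
    intro j _
    rcases j with k | k
    · simp only [hw_def, Sum.elim_inl]
      linarith [hstep k]
    · simp only [hw_def, Sum.elim_inr]
      linarith [hstep k]
  have hK : ∀ j ∈ (Finset.range N).disjSum (Finset.range N), t j = 0 → K j = 1 ∨ w j = 0 := by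
    intro j _ hj0
    rcases j with k | k
    · left
      have hk0 : k = 0 := by
        by_contra hne
        have : a 0 < a k := hmono (Nat.pos_of_ne_zero hne)
        simp only [ht_def, Sum.elim_inl] at hj0
        linarith [hak0 k]
      subst hk0
      simpa [hK_def] using hK0
    · exfalso
      simp only [ht_def, Sum.elim_inr] at hj0
      linarith [hstep k, hak0 k]
  have hrule : ∀ y : ℝ, 0 < y → Real.log y ≤
      ∑ j ∈ (Finset.range N).disjSum (Finset.range N), w j * ((y - 1) / (1 + t j * (y - 1))) := by
    intro y hy
    rw [Finset.sum_disjSum]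
    have h := log_le_radauTwo_composite a N hmono.monotone h0 hN hy
    calc Real.log y ≤ _ := h
      _ = _ := by
        rw [← Finset.sum_add_distrib]
        refine Finset.sum_congr rfl fun k _ => ?_
        simp only [ht_def, hw_def, Sum.elim_inl, Sum.elim_inr]
        ring
  have main := posSemidef_oneParam_of_perspectiveTangent ((Finset.range N).disjSum (Finset.range N))
    hW t w K ht hw hK hrule x
  rw [Finset.sum_disjSum, Finset.sum_disjSum] at main
  simpa only [ht_def, hw_def, hK_def, Sum.elim_inl, Sum.elim_inr] using main

end Packaged

end Literature.MathematicalPhysics.QuantumLattice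

end
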